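import Summits.QuantumFields.YangMills.Theorems.BalabanUVNodesK2JsOfRecord
import Literature.MathematicalPhysics.QuantumFieldTheory.Balaban1983to89.Beta.RemainderResidue
import Literature.MathematicalPhysics.QuantumFieldTheory.Balaban1983to89.Beta.DriftRemainder
import Summits.QuantumFields.BalabanUV.Gaps.CapSignsConstRoad
import Summits.QuantumFields.YangMills.Theorems.BalabanUVNodesK1EndOfNodes13PWSOfPartialSums

/-!
# BalabanUVNodes ∕ K1⁷ — THE CRUX's β-SIDE IN K2⁷'s CURRENT (v3, LINE 1′ «named jets») CURRENCY: `StabilityBAtRecordR13SepCoPH` BY NAME from K1⁷'s STUB 1 in ceiling-uniform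
# form and K2⁷'s two registered stub texts `D1AtShadowingJets` ∧ `RemAtSomeJets` (plan g80 `K2Skeleton13SepCoPHv3`, bdd723a03d54) — the remainder package `RemAt` CARRIES the
# ceiling, so NO β letter is left on the K1 side

TRACK A (YM-PLAN §2d), node N24 (binder B2, COMPOSITE), WIDTH SEAT `pub-ymgap-dag-n24-w1` (director-ym №197 ∕ HUMAN RULING D-0149; plan W-SEAT-START-LIST §1 n24 ITEM 1, fifth
module).  Key of record: K1⁷ `StabilityBAtRecordR13SepCoPH` = stmt-QuantumFields-20542; `--supports` it AS A HELPER (count-neutral).  Companions: this seat's `…K1EndOfNodes13PWSOfPartialSums`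
(p588006: (2.6) [III] and the END headline from BOUNDED-BELOW PARTIAL SUMS; the θ-keyed `stabilityB_body_of_rung1At_of_partialSumsH_of_ceiling`) and `…K1EndOfNodes13PWSOfK2Pair`
(p588994: the same fed by K2⁷'s rev-24 (190)-chain pair `D1AtRecord13` ∧ `D4AtSlopeOfD1Record13`, superseded as registered texts by plan g80's v3 at 00:31Z 2026-08-28 but kept on
v3's line 2); THIS file is the v3 LINE-1′ edition, reading DEF-1's helper `BalabanUVNodesK2JsOfRecord` (`StepColourData`, `beta0OfJs`, `BoxRemainder`,
`betaPartialSumsLowerH_of_drift_boxRemainder`) BY NAME.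

THE POINT.  v3's shared letter `RemAt F κ θ hP` = «on SOME box `]0, γ₀] ⊆ ]0, θ.γ]`: `|β_{k+1}(p) − beta0OfJs F κ k| ≤ C_r·p_k` (`BoxRemainder`), seam `C_r γ₀ ≤ stepBal 2 F.L`, (C), and
the printed ceiling `BetaUpperH β′ γ₀`»; stub 1′ `D1AtShadowingJets` = «`RemAt` ⟹ the named numbers drift with slope `stepBal 2 F.L`».  DEF-1's `betaPartialSumsLowerH_of_drift_boxRemainder`
turns the two into `FlowStepRuns.BetaPartialSumsLowerH 2A γ₀ D.βfun`; `RemAt` itself hands the ceiling `β′`.  So the companion's θ-keyed consequent needs NOTHING beyond the two v3 stub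
texts at θ and a rung-1 world whose ceiling `w.βup` is at least `β′` — which a CEILING-UNIFORM rung-1 family supplies by choice.
* §1 ★★ `stabilityB_body_of_rung1At_of_drift_boxRemainder_of_ceiling` (general `N`, generic reference sequence `b`, slope `s`) — the consequent at θ from a rung-1 datum +
  `OneLoopDrift s A b` + `BoxRemainder (datumOfRecord₁₃SepCoPH θ h).βfun b C_r γ₀` + `0 ≤ C_r` + `C_r γ₀ ≤ s` + `BetaUpperH w.βup γ₀ (…).βfun`.
* §1b ★★ `stabilityB_body_of_rung1At_of_drift_remainderConst_le` (general `N`) — the consequent at θ from a rung-1 datum + `OneLoopDrift d A β⁰_θ` + the CONSTANT-FORM remainder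
  `RemainderConst (split₁₃ θ) γ₀ s` + `s ≤ d` + ceiling `d + 2A + s ≤ w.βup` — NO continuity; the common consumer of K2⁷'s line 1 (rev 24) and v3's line 2 (`everySlope_of_shiftRate_anchor`
  at `s := stepBal`); `stabilityB_body_of_rung1At_of_drift_everySlope` — the same fed by line 2's lever output `Gaps.EverySlope` at `s := d`.
* §2 ★★★ `stabilityB_body_of_rung1At_of_remAt_of_d1Shadowing` (`N = 2`) — the consequent at θ from a rung-1 datum + the BODY of `RemAt F κ θ h` (spelled out) + stub 1′'s drift
  conclusion for that κ + the ceiling match `β′ ≤ w.βup` for the package's `β′` (stated as: the package's ceiling constant is at most `w.βup`).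
* §3 ★★★★★ `stabilityBAtRecordR13SepCoPH_of_stub1CeilingUniform_of_k2NamedJetsStubs` (`N = 2`) — THE ROUTE DECL BY NAME from the CEILING-UNIFORM rung-1 text
  («`∃ θ h, (ZhUnity ∧ SlotsNondegenerate₁₃) ∧ Admissible ∧ ∀ c, ∃ w, c ≤ w.βup ∧ RecordS θ h w ∧ ∀ P, Nodes (leavesP w P)`») and K2⁷ v3's `D1AtShadowingJets` ∧ `RemAtSomeJets` texts
  VERBATIM — no β letter on the K1 side.
* §4 ★★★★ `stabilityBAtRecordR13SepCoPH_of_stub1_of_k2NamedJetsStubs_of_ceiling_at_witness` (`N = 2`) — the same from the REGISTERED rung-1 text (v5, `RecordS` unfolded) plus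
  «at every rung-1 witness: every `RemAt`-package ceiling is at most `w.βup`» (the non-uniform form: the ceiling match is the one K1-side letter).

HONEST SCOPE ∕ A6.  Implications only; the rung-1 texts, K2⁷'s stub texts and the ceiling match are DISPLAYED hypotheses inhabited at NO θ here («not exhibited», №167); K2⁷ v3's stubs
are OPEN ((P6) — the VALUE of κ — unpinned; instance 0∕1); whether the rung-1 children's deliveries are ceiling-uniform is the rung-1 lanes' mathematics, NOT claimed.  Nothing of Bałaban
asserted; K1⁷ ∕ K2⁷ NOT closed; N24 COMPOSITE — no discharge, no count claim (typed 28∕28 · discharged 5∕27 unmoved).  One finite 𝕋⁴ programme at fixed ε, Bałaban AS PRINTED; R4 closes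
ONLY the conditional finite-𝕋⁴ rung `BalabanLadder.UV` — the YM mass gap (Clay) is NOT proved by any of this; nothing continuum ∕ ℝ⁴ ∕ OS.  Theorems only: no `def`, no `instance`, no
`sorry`, standard axioms.
-/

noncomputable section

open scoped Matrix.Norms.L2Operator

namespace Summit.QuantumFields.YangMills.BalabanUVNodes.K1EndOfNodes13PWSOfK2NamedJets

open Literature.MathematicalPhysics.QuantumFieldTheory.Balaban1983to89
open Literature.MathematicalPhysics.QuantumFieldTheory.Balaban1983to89.Node00
open DagBinding T4Continuum T4DatumAssembly FlowStepRuns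
open FlowStep (HBeta BetaUpperH BetaContH box_mono)
open Literature.MathematicalPhysics.QuantumFieldTheory.Balaban1983to89.Beta.Drift (OneLoopDrift)
open Summit.QuantumFields.YangMills.Theorems.BalabanUVNodesK2JsOfRecord (StepColourData beta0OfJs BoxRemainder betaPartialSumsLowerH_of_drift_boxRemainder)
open Summit.QuantumFields.YangMills.BalabanUVNodes.K1EndOfNodes13PWSOfPartialSums (stabilityB_body_of_rung1At_of_partialSumsH_of_ceiling)
open Literature.MathematicalPhysics.QuantumFieldTheory.Balaban1983to89.Beta.RemainderChain (RemainderConst)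
open Literature.MathematicalPhysics.QuantumFieldTheory.Balaban1983to89.Beta.RemainderResidue (betaPartialSumsLowerH_of_drift_windowedLower windowedLower_of_remainderConst)
open Literature.MathematicalPhysics.QuantumFieldTheory.Balaban1983to89.Beta.DriftRemainder (betaUpperH_of_drift_remainderConst)
open Summit.QuantumFields.BalabanUV.Gaps.CapSignsConstRoad (EverySlope)

/-! ## §1. ★★ The consequent at θ from a drifting reference sequence and a box remainder (split-free, `limUnder`-free letters) -/

section BoxRemainderRoad

variable {F : T4Family} {N : ℕ} [NeZero N]

/-- **★★ THE CRUX's CONSEQUENT AT θ FROM A RUNG-1 DATUM, A DRIFTING REFERENCE SEQUENCE AND A BOX REMAINDER** — DEF-1's split-free letters: a reference sequence `b` drifting with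
slope `s` and cumulative defect `A` (`OneLoopDrift s A b`), the datum's β within `C_r·g_k` of `b_k` on `]0, γ₀]`-histories (`BoxRemainder`), `0 ≤ C_r`, the seam `C_r γ₀ ≤ s`, and the
ceiling `BetaUpperH w.βup γ₀`: partial sums `≥ −2A` by DEF-1's `betaPartialSumsLowerH_of_drift_boxRemainder`, then the companion's θ-keyed theorem.  CONDITIONAL; nothing of Bałaban
asserted; K1⁷ NOT closed. [cite: Balaban1987RG1, Thm 2 p.259, (2.12)–(2.14) p.268, §1 (1.22) p.264; Balaban1989LargeFieldII, Thm 1 p.355; Balaban1988Convergent, (2.6) p.255 (bookkeeping)] -/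
theorem stabilityB_body_of_rung1At_of_drift_boxRemainder_of_ceiling (θ : Stage13HParams F N) (h : θ.Provisos₁₃SepCoPH F N) (w : WorldP)
    (hU : θ.ZhUnity F N ∧ θ.SlotsNondegenerate₁₃ F N) (hθ : θ.Admissible F N)
    (hR : ∃ (θ' : Stage13HParams F N) (h' : θ'.Provisos₁₃SepCoPH F N), θ'.Admissible F N ∧
      datumOfRecord₁₃SepCoPH F N θ h = datumOfRecord₁₃SepCoPH F N θ' h' ∧ w.C = (datumOfRecord₁₃SepCoPH F N θ h).C ∧ (0 < w.γ ∧ w.γ ≤ θ'.γ) ∧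
      w.L = (θ'.L : ℝ) ∧ ∀ P : B12.RunParams, w.up P = upOfRecord₅CS F N (θ'.toStage5₁₃CoPH F N) P)
    (hnodes : ∀ P : B12.RunParams, Nodes (leavesP w P))
    {b : ℕ → ℝ} {s A Cr γ₀ : ℝ} (hγ₀ : 0 < γ₀) (hdrift : OneLoopDrift s A b)
    (hrem : BoxRemainder (datumOfRecord₁₃SepCoPH F N θ h).βfun b Cr γ₀) (hCr : 0 ≤ Cr) (hseam : Cr * γ₀ ≤ s)
    (hhi : BetaUpperH w.βup γ₀ (datumOfRecord₁₃SepCoPH F N θ h).βfun) :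
    (θ.ZhUnity F N ∧ θ.SlotsNondegenerate₁₃ F N) ∧ θ.Admissible F N ∧ B16.EndStatementBPrinted (datumOfRecord₁₃SepCoPH F N θ h).C ∧
      ∃ γ₁ : ℝ, 0 < γ₁ ∧ ∀ γ : ℝ, 0 < γ → γ ≤ γ₁ → ∃ P : B12.RunParams, 1 ≤ P.K ∧ ((datumOfRecord₁₃SepCoPH F N θ h).C P).flow.InInterval γ P.K :=
  stabilityB_body_of_rung1At_of_partialSumsH_of_ceiling θ h w hU hθ hR hnodes hγ₀ (betaPartialSumsLowerH_of_drift_boxRemainder hdrift hrem hCr hseam) hhi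

end BoxRemainderRoad

/-! ## §1b. ★★ The same from a drifting one-loop sequence and the CONSTANT-FORM remainder `RemainderConst` — the letter BOTH of K2⁷ v3's lines return (line 1 rev-24: `AtSlopeCont ⟹
RemainderConst`; line 2: the skeleton's `everySlope_of_shiftRate_anchor` returns `RemainderConst` at EVERY slope, in particular at `s := stepBal`); NO continuity (C) is read on the (B)-road -/

section RemainderConstRoad

variable {F : T4Family} {N : ℕ} [NeZero N]

/-- **★★ THE CRUX's CONSEQUENT AT θ FROM A RUNG-1 DATUM, THE (D1) DRIFT AND A CONSTANT-FORM REMAINDER BOUND** — letters: `OneLoopDrift d A β⁰_θ` (the record's one-loop numbers, `|Σ_{j<k} β⁰_j − d·k| ≤ A`),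
`RemainderConst (split₁₃ θ) γ₀ s` (`|β¹| ≤ s` on `]0, γ₀]^{k+1}`; [Balaban1987RG1] (2.13)–(2.14) p.268 in k-uniform constant form), the slope condition `s ≤ d` and the ceiling
`d + 2A + s ≤ w.βup`.  Partial sums `≥ −2A` (`Beta.RemainderResidue`), ceiling `d + 2A + s` (`Beta.DriftRemainder.betaUpperH_of_drift_remainderConst`), then the companion's θ-keyed theorem.
NO continuity letter — the (B)-road does not read (C).  This is the common consumer of K2⁷'s line 1 (rev 24: `Gaps.BetaContFromD4Chain.remainderConst_of_atSlopeCont`) and line 2 (v3 §L2.1: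
`everySlope_of_shiftRate_anchor` at `s := stepBal`, together with `D1AtRecord13Pos`'s residue and positive slope).  CONDITIONAL; nothing of Bałaban asserted; K1⁷ ∕ K2⁷ NOT closed.
[cite: Balaban1987RG1, Thm 2 p.259, (2.12)–(2.14) p.268, §1 (1.22) p.264; Balaban1988RG2Cluster, Lemma 3 (2.38) p.20; Balaban1989LargeFieldII, Thm 1 p.355; Balaban1988Convergent, (2.6) p.255 (bookkeeping)] -/
theorem stabilityB_body_of_rung1At_of_drift_remainderConst_le (θ : Stage13HParams F N) (h : θ.Provisos₁₃SepCoPH F N) (w : WorldP)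
    (hU : θ.ZhUnity F N ∧ θ.SlotsNondegenerate₁₃ F N) (hθ : θ.Admissible F N)
    (hR : ∃ (θ' : Stage13HParams F N) (h' : θ'.Provisos₁₃SepCoPH F N), θ'.Admissible F N ∧
      datumOfRecord₁₃SepCoPH F N θ h = datumOfRecord₁₃SepCoPH F N θ' h' ∧ w.C = (datumOfRecord₁₃SepCoPH F N θ h).C ∧ (0 < w.γ ∧ w.γ ≤ θ'.γ) ∧
      w.L = (θ'.L : ℝ) ∧ ∀ P : B12.RunParams, w.up P = upOfRecord₅CS F N (θ'.toStage5₁₃CoPH F N) P)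
    (hnodes : ∀ P : B12.RunParams, Nodes (leavesP w P))
    {d A γ₀ s : ℝ} (hγ₀ : 0 < γ₀)
    (hdrift : letI := θ.instVβ₁; letI := θ.instVβ₂; letI := θ.instιβ
      OneLoopDrift d A (beta0OfMerged (betaMerged F (mergedTermFamilyMatT F N (TcanOfRecord F N) (chiFixed29 F N θ.ν θ.ε₂₉) θ.εbg) θ.ρ8 θ.bV) θ.v₀))
    (hrem : letI := θ.instVβ₁; letI := θ.instVβ₂; letI := θ.instιβ
      RemainderConst
        (oneLoopSplit_betaOfMerged (betaMerged F (mergedTermFamilyMatT F N (TcanOfRecord F N) (chiFixed29 F N θ.ν θ.ε₂₉) θ.εbg) θ.ρ8 θ.bV)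
          (beta0OfMerged (betaMerged F (mergedTermFamilyMatT F N (TcanOfRecord F N) (chiFixed29 F N θ.ν θ.ε₂₉) θ.εbg) θ.ρ8 θ.bV) θ.v₀) θ.γ)
        γ₀ s)
    (hsd : s ≤ d) (hceil : d + 2 * A + s ≤ w.βup) :
    (θ.ZhUnity F N ∧ θ.SlotsNondegenerate₁₃ F N) ∧ θ.Admissible F N ∧ B16.EndStatementBPrinted (datumOfRecord₁₃SepCoPH F N θ h).C ∧
      ∃ γ₁ : ℝ, 0 < γ₁ ∧ ∀ γ : ℝ, 0 < γ → γ ≤ γ₁ → ∃ P : B12.RunParams, 1 ≤ P.K ∧ ((datumOfRecord₁₃SepCoPH F N θ h).C P).flow.InInterval γ P.K := by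
  letI := θ.instVβ₁; letI := θ.instVβ₂; letI := θ.instιβ
  have hps : BetaPartialSumsLowerH (2 * A + 0) γ₀ (betaOfRecord₁₃ F N θ.toStage13Params) :=
    betaPartialSumsLowerH_of_drift_windowedLower _ hdrift (windowedLower_of_remainderConst _ hrem) hsd
  have hup : BetaUpperH (d + 2 * A + s) γ₀ (betaOfRecord₁₃ F N θ.toStage13Params) := betaUpperH_of_drift_remainderConst _ hdrift hrem
  exact stabilityB_body_of_rung1At_of_partialSumsH_of_ceiling θ h w hU hθ hR hnodes hγ₀ hps (fun k v hv => (hup k v hv).trans hceil)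

/-- **★★ … AND FROM v3 LINE 2's LEVER OUTPUT `EverySlope`** (`Gaps.CapSignsConstRoad.EverySlope`: `RemainderConst` on SOME box at EVERY positive slope — what the skeleton's
`everySlope_of_shiftRate_anchor` returns from `D4ShiftRateRecord13` ∧ `D4AnchorRecord13`): with the (D1) drift at a POSITIVE slope `d` (`D1AtRecord13Pos`), take `s := d`; ceiling
`d + 2A + d ≤ w.βup`.  CONDITIONAL; K1⁷ ∕ K2⁷ NOT closed. [cite: Balaban1987RG1, Thm 2 p.259, Thm 3 p.264, (2.12)–(2.14) p.268; Balaban1988Convergent, (2.6) p.255 (bookkeeping)] -/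
theorem stabilityB_body_of_rung1At_of_drift_everySlope (θ : Stage13HParams F N) (h : θ.Provisos₁₃SepCoPH F N) (w : WorldP)
    (hU : θ.ZhUnity F N ∧ θ.SlotsNondegenerate₁₃ F N) (hθ : θ.Admissible F N)
    (hR : ∃ (θ' : Stage13HParams F N) (h' : θ'.Provisos₁₃SepCoPH F N), θ'.Admissible F N ∧
      datumOfRecord₁₃SepCoPH F N θ h = datumOfRecord₁₃SepCoPH F N θ' h' ∧ w.C = (datumOfRecord₁₃SepCoPH F N θ h).C ∧ (0 < w.γ ∧ w.γ ≤ θ'.γ) ∧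
      w.L = (θ'.L : ℝ) ∧ ∀ P : B12.RunParams, w.up P = upOfRecord₅CS F N (θ'.toStage5₁₃CoPH F N) P)
    (hnodes : ∀ P : B12.RunParams, Nodes (leavesP w P))
    {d A γc : ℝ} (hd : 0 < d)
    (hdrift : letI := θ.instVβ₁; letI := θ.instVβ₂; letI := θ.instιβ
      OneLoopDrift d A (beta0OfMerged (betaMerged F (mergedTermFamilyMatT F N (TcanOfRecord F N) (chiFixed29 F N θ.ν θ.ε₂₉) θ.εbg) θ.ρ8 θ.bV) θ.v₀))
    (hev : letI := θ.instVβ₁; letI := θ.instVβ₂; letI := θ.instιβ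
      EverySlope
        (oneLoopSplit_betaOfMerged (betaMerged F (mergedTermFamilyMatT F N (TcanOfRecord F N) (chiFixed29 F N θ.ν θ.ε₂₉) θ.εbg) θ.ρ8 θ.bV)
          (beta0OfMerged (betaMerged F (mergedTermFamilyMatT F N (TcanOfRecord F N) (chiFixed29 F N θ.ν θ.ε₂₉) θ.εbg) θ.ρ8 θ.bV) θ.v₀) θ.γ)
        γc)
    (hceil : d + 2 * A + d ≤ w.βup) :
    (θ.ZhUnity F N ∧ θ.SlotsNondegenerate₁₃ F N) ∧ θ.Admissible F N ∧ B16.EndStatementBPrinted (datumOfRecord₁₃SepCoPH F N θ h).C ∧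
      ∃ γ₁ : ℝ, 0 < γ₁ ∧ ∀ γ : ℝ, 0 < γ → γ ≤ γ₁ → ∃ P : B12.RunParams, 1 ≤ P.K ∧ ((datumOfRecord₁₃SepCoPH F N θ h).C P).flow.InInterval γ P.K := by
  obtain ⟨γ₀, hγ₀, -, hrem⟩ := hev d hd
  exact stabilityB_body_of_rung1At_of_drift_remainderConst_le θ h w hU hθ hR hnodes hγ₀ hdrift hrem le_rfl hceil

end RemainderConstRoad

/-! ## §2. ★★★ `N = 2`: the consequent at θ from the BODY of v3's `RemAt F κ θ h`, stub 1′'s drift for κ, and the ceiling match -/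

section NamedJets

variable {F : T4Family}

/-- **★★★ THE CRUX's CONSEQUENT AT θ FROM A RUNG-1 DATUM AND K2⁷ v3's LINE-1′ LETTERS AT θ** — `hRem` = the BODY of plan g80's `RemAt F κ θ h` VERBATIM (box `]0, γ₀] ⊆ ]0, θ.γ]`,
`BoxRemainder` against the named numbers `beta0OfJs F κ`, seam `C_r γ₀ ≤ stepBal 2 F.L`, (C), ceiling `β′`), `hD1κ` = stub 1′'s conclusion for that κ (`∃ A, OneLoopDrift (stepBal 2 F.L) A
(beta0OfJs F κ)`), `hceil` = «every ceiling constant of such a package is at most `w.βup`» (the ceiling match, stated without opening the package).  CONDITIONAL; (P6) unpinned; nothing of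
Bałaban asserted; K1⁷ ∕ K2⁷ NOT closed. [cite: Balaban1987RG1, Thm 2 p.259, (2.12)–(2.14) p.268, §1 (1.22) p.264; Balaban1988RG2Cluster, Lemma 3 (2.38) p.20; Balaban1989LargeFieldII, Thm 1 p.355; Balaban1988Convergent, (2.6) p.255 (bookkeeping)] -/
theorem stabilityB_body_of_rung1At_of_remAt_of_d1Shadowing (θ : Stage13HParams F 2) (h : θ.Provisos₁₃SepCoPH F 2) (w : WorldP)
    (hU : θ.ZhUnity F 2 ∧ θ.SlotsNondegenerate₁₃ F 2) (hθ : θ.Admissible F 2)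
    (hR : ∃ (θ' : Stage13HParams F 2) (h' : θ'.Provisos₁₃SepCoPH F 2), θ'.Admissible F 2 ∧
      datumOfRecord₁₃SepCoPH F 2 θ h = datumOfRecord₁₃SepCoPH F 2 θ' h' ∧ w.C = (datumOfRecord₁₃SepCoPH F 2 θ h).C ∧ (0 < w.γ ∧ w.γ ≤ θ'.γ) ∧
      w.L = (θ'.L : ℝ) ∧ ∀ P : B12.RunParams, w.up P = upOfRecord₅CS F 2 (θ'.toStage5₁₃CoPH F 2) P)
    (hnodes : ∀ P : B12.RunParams, Nodes (leavesP w P)) (κ : StepColourData)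
    (hRem : ∃ γ₀ Cr β' : ℝ, 0 < γ₀ ∧ γ₀ ≤ θ.γ ∧ 0 ≤ Cr ∧ 0 ≤ β' ∧
      BoxRemainder (datumOfRecord₁₃SepCoPH F 2 θ h).βfun (beta0OfJs F κ) Cr γ₀ ∧
      Cr * γ₀ ≤ B12Normalization.stepBal 2 F.L ∧
      BetaContH γ₀ (datumOfRecord₁₃SepCoPH F 2 θ h).βfun ∧
      BetaUpperH β' γ₀ (datumOfRecord₁₃SepCoPH F 2 θ h).βfun)
    (hD1κ : ∃ A : ℝ, OneLoopDrift (B12Normalization.stepBal 2 F.L) A (beta0OfJs F κ))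
    (hceil : ∀ γ₀ β' : ℝ, 0 < γ₀ → BetaUpperH β' γ₀ (datumOfRecord₁₃SepCoPH F 2 θ h).βfun → ∃ γ₁ : ℝ, 0 < γ₁ ∧ γ₁ ≤ γ₀ ∧ BetaUpperH w.βup γ₁ (datumOfRecord₁₃SepCoPH F 2 θ h).βfun) :
    (θ.ZhUnity F 2 ∧ θ.SlotsNondegenerate₁₃ F 2) ∧ θ.Admissible F 2 ∧ B16.EndStatementBPrinted (datumOfRecord₁₃SepCoPH F 2 θ h).C ∧
      ∃ γ₁ : ℝ, 0 < γ₁ ∧ ∀ γ : ℝ, 0 < γ → γ ≤ γ₁ → ∃ P : B12.RunParams, 1 ≤ P.K ∧ ((datumOfRecord₁₃SepCoPH F 2 θ h).C P).flow.InInterval γ P.K := by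
  obtain ⟨γ₀, Cr, β', hγ₀, -, hCr, -, hrem, hseam, -, hup⟩ := hRem
  obtain ⟨A, hA⟩ := hD1κ
  obtain ⟨γ₁, hγ₁, hγ₁₀, hhi⟩ := hceil γ₀ β' hγ₀ hup
  exact stabilityB_body_of_rung1At_of_drift_boxRemainder_of_ceiling θ h w hU hθ hR hnodes hγ₁ hA (hrem.mono hγ₁₀) hCr
    ((mul_le_mul_of_nonneg_left hγ₁₀ hCr).trans hseam) hhi

end NamedJets

/-! ## §3–§4. ★★★★★ `N = 2`: the ROUTE DECL BY NAME from K1⁷'s stub 1 (ceiling-uniform ∕ registered + ceiling match) and K2⁷ v3's `D1AtShadowingJets` ∧ `RemAtSomeJets` texts -/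

section Registered

/-- **★★★★★ K1⁷ BY NAME WITH NO β LETTER ON THE K1 SIDE, IN K2⁷ v3's CURRENCY**: a CEILING-UNIFORM rung-1 family at one unity tuple (`∀ c, ∃ w, c ≤ w.βup ∧ RecordS θ h w ∧ nodes`; plan's
`RecordS` spelled out; the rung's `PrintedUV3V` ∕ [IV]-pin conjuncts are not read by the consequent and are omitted) and K2⁷ v3's two registered stub texts — `hD1` = `D1AtShadowingJets`,
`hRem` = `RemAtSomeJets`, VERBATIM from plan g80's `K2Skeleton13SepCoPHv3` with `RemAt` unfolded — give `Summit.QuantumFields.YangMills.Theses.BalabanUVNodes.StabilityBAtRecordR13SepCoPH`.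
Road: κ from `hRem`; the package at `(θ, h)`; the drift for κ from `hD1`; a world with `w.βup ≥ β′` from the family; §1.  CONDITIONAL on the three displayed hypotheses; (P6) unpinned; K1⁷ ∕ K2⁷
NOT closed; nothing of Bałaban asserted; no count moved. [cite: Balaban1989LargeFieldII, Thm 1 p.355 + (0.1) pp.355–356 + p.391; Balaban1987RG1, Thm 2 p.259, (2.12)–(2.14) p.268, §1 (1.22) p.264; Balaban1988RG2Cluster, Lemma 3 (2.38) p.20; Balaban1988Convergent, (2.6) p.255 and Cor. 3 (2.50) p.264 (bookkeeping)] -/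
theorem stabilityBAtRecordR13SepCoPH_of_stub1CeilingUniform_of_k2NamedJetsStubs
    (h₁ : ∀ F : T4Family, (∃ θ : Stage13HParams F 2, θ.Provisos₁₃SepCoPH F 2 ∧ (θ.ZhUnity F 2 ∧ θ.SlotsNondegenerate₁₃ F 2) ∧ θ.Admissible F 2) →
      ∃ (θ : Stage13HParams F 2) (h : θ.Provisos₁₃SepCoPH F 2), (θ.ZhUnity F 2 ∧ θ.SlotsNondegenerate₁₃ F 2) ∧ θ.Admissible F 2 ∧
        ∀ c : ℝ, ∃ w : WorldP, c ≤ w.βup ∧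
          (∃ (θ' : Stage13HParams F 2) (h' : θ'.Provisos₁₃SepCoPH F 2), θ'.Admissible F 2 ∧
            datumOfRecord₁₃SepCoPH F 2 θ h = datumOfRecord₁₃SepCoPH F 2 θ' h' ∧ w.C = (datumOfRecord₁₃SepCoPH F 2 θ h).C ∧ (0 < w.γ ∧ w.γ ≤ θ'.γ) ∧
            w.L = (θ'.L : ℝ) ∧ ∀ P : B12.RunParams, w.up P = upOfRecord₅CS F 2 (θ'.toStage5₁₃CoPH F 2) P) ∧
          (∀ P : B12.RunParams, Nodes (leavesP w P)))
    (hD1 : ∀ (F : T4Family) (κ : StepColourData) (θ : Stage13HParams F 2) (hP : θ.Provisos₁₃SepCoPH F 2), θ.Admissible F 2 →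
      (∃ γ₀ Cr β' : ℝ, 0 < γ₀ ∧ γ₀ ≤ θ.γ ∧ 0 ≤ Cr ∧ 0 ≤ β' ∧
        BoxRemainder (datumOfRecord₁₃SepCoPH F 2 θ hP).βfun (beta0OfJs F κ) Cr γ₀ ∧
        Cr * γ₀ ≤ B12Normalization.stepBal 2 F.L ∧
        BetaContH γ₀ (datumOfRecord₁₃SepCoPH F 2 θ hP).βfun ∧
        BetaUpperH β' γ₀ (datumOfRecord₁₃SepCoPH F 2 θ hP).βfun) →
      ∃ A : ℝ, OneLoopDrift (B12Normalization.stepBal 2 F.L) A (beta0OfJs F κ))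
    (hRem : ∀ F : T4Family, ∃ κ : StepColourData,
      ∀ (θ : Stage13HParams F 2) (hP : θ.Provisos₁₃SepCoPH F 2), θ.Admissible F 2 →
        ∃ γ₀ Cr β' : ℝ, 0 < γ₀ ∧ γ₀ ≤ θ.γ ∧ 0 ≤ Cr ∧ 0 ≤ β' ∧
          BoxRemainder (datumOfRecord₁₃SepCoPH F 2 θ hP).βfun (beta0OfJs F κ) Cr γ₀ ∧
          Cr * γ₀ ≤ B12Normalization.stepBal 2 F.L ∧
          BetaContH γ₀ (datumOfRecord₁₃SepCoPH F 2 θ hP).βfun ∧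
          BetaUpperH β' γ₀ (datumOfRecord₁₃SepCoPH F 2 θ hP).βfun) :
    Summit.QuantumFields.YangMills.Theses.BalabanUVNodes.StabilityBAtRecordR13SepCoPH := by
  intro F hinh
  obtain ⟨θ, h, hU, hθ, hfam⟩ := h₁ F hinh
  obtain ⟨κ, hκ⟩ := hRem F
  have hpack := hκ θ h hθ
  obtain ⟨A, hA⟩ := hD1 F κ θ h hθ hpack
  obtain ⟨γ₀, Cr, β', hγ₀, -, hCr, -, hrem, hseam, -, hup⟩ := hpack
  obtain ⟨w, hc, hR, hnodes⟩ := hfam β'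
  exact ⟨θ, h, stabilityB_body_of_rung1At_of_drift_boxRemainder_of_ceiling θ h w hU hθ hR hnodes hγ₀ hA hrem hCr hseam (fun k v hv => (hup k v hv).trans hc)⟩

/-- **★★★★ THE SAME FROM THE REGISTERED RUNG-1 TEXT (v5, `RecordS` unfolded) PLUS THE CEILING MATCH AT EVERY RUNG-1 WITNESS** — `hceil` = «at every rung-1 witness `(θ, h, w)`: whenever the
datum's β is bounded by SOME `β′` on SOME box, it is bounded by `w.βup` on a (possibly smaller) box» (the one K1-side letter of the non-uniform form; it holds e.g. when the witness's world was
built with `w.βup` at least the package's `β′`).  CONDITIONAL; closes nothing. [cite: Balaban1989LargeFieldII, Thm 1 p.355 + (0.1) pp.355–356 + p.391; Balaban1987RG1, Thm 2 p.259, §1 (1.22) p.264; Balaban1988Convergent, (2.6) p.255 (bookkeeping)] -/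
theorem stabilityBAtRecordR13SepCoPH_of_stub1_of_k2NamedJetsStubs_of_ceiling_at_witness
    (h₁ : ∀ F : T4Family, (∃ θ : Stage13HParams F 2, θ.Provisos₁₃SepCoPH F 2 ∧ (θ.ZhUnity F 2 ∧ θ.SlotsNondegenerate₁₃ F 2) ∧ θ.Admissible F 2) →
      ∃ (θ : Stage13HParams F 2) (h : θ.Provisos₁₃SepCoPH F 2) (w : WorldP), (θ.ZhUnity F 2 ∧ θ.SlotsNondegenerate₁₃ F 2) ∧ θ.Admissible F 2 ∧
        (∃ (θ' : Stage13HParams F 2) (h' : θ'.Provisos₁₃SepCoPH F 2), θ'.Admissible F 2 ∧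
          datumOfRecord₁₃SepCoPH F 2 θ h = datumOfRecord₁₃SepCoPH F 2 θ' h' ∧ w.C = (datumOfRecord₁₃SepCoPH F 2 θ h).C ∧ (0 < w.γ ∧ w.γ ≤ θ'.γ) ∧
          w.L = (θ'.L : ℝ) ∧ ∀ P : B12.RunParams, w.up P = upOfRecord₅CS F 2 (θ'.toStage5₁₃CoPH F 2) P) ∧
        (∀ P : B12.RunParams, Nodes (leavesP w P)) ∧ PrintedUV3V 2 θ.L ∧
        ∃ lam : ResidW F 2, (∀ P : B12.RunParams, 1 ≤ P.K → lam.kSel P < P.K) ∧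
          ∀ P : B12.RunParams, lam.kSel P < P.K → ((leavesP w P).rBasicStep ↔ B15Leaf (WOfRecord₁₃ F 2 θ.toStage13Params lam P)))
    (hD1 : ∀ (F : T4Family) (κ : StepColourData) (θ : Stage13HParams F 2) (hP : θ.Provisos₁₃SepCoPH F 2), θ.Admissible F 2 →
      (∃ γ₀ Cr β' : ℝ, 0 < γ₀ ∧ γ₀ ≤ θ.γ ∧ 0 ≤ Cr ∧ 0 ≤ β' ∧
        BoxRemainder (datumOfRecord₁₃SepCoPH F 2 θ hP).βfun (beta0OfJs F κ) Cr γ₀ ∧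
        Cr * γ₀ ≤ B12Normalization.stepBal 2 F.L ∧
        BetaContH γ₀ (datumOfRecord₁₃SepCoPH F 2 θ hP).βfun ∧
        BetaUpperH β' γ₀ (datumOfRecord₁₃SepCoPH F 2 θ hP).βfun) →
      ∃ A : ℝ, OneLoopDrift (B12Normalization.stepBal 2 F.L) A (beta0OfJs F κ))
    (hRem : ∀ F : T4Family, ∃ κ : StepColourData,
      ∀ (θ : Stage13HParams F 2) (hP : θ.Provisos₁₃SepCoPH F 2), θ.Admissible F 2 →
        ∃ γ₀ Cr β' : ℝ, 0 < γ₀ ∧ γ₀ ≤ θ.γ ∧ 0 ≤ Cr ∧ 0 ≤ β' ∧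
          BoxRemainder (datumOfRecord₁₃SepCoPH F 2 θ hP).βfun (beta0OfJs F κ) Cr γ₀ ∧
          Cr * γ₀ ≤ B12Normalization.stepBal 2 F.L ∧
          BetaContH γ₀ (datumOfRecord₁₃SepCoPH F 2 θ hP).βfun ∧
          BetaUpperH β' γ₀ (datumOfRecord₁₃SepCoPH F 2 θ hP).βfun)
    (hceil : ∀ (F : T4Family) (θ : Stage13HParams F 2) (h : θ.Provisos₁₃SepCoPH F 2) (w : WorldP),
      (θ.ZhUnity F 2 ∧ θ.SlotsNondegenerate₁₃ F 2) → θ.Admissible F 2 →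
      (∃ (θ' : Stage13HParams F 2) (h' : θ'.Provisos₁₃SepCoPH F 2), θ'.Admissible F 2 ∧
        datumOfRecord₁₃SepCoPH F 2 θ h = datumOfRecord₁₃SepCoPH F 2 θ' h' ∧ w.C = (datumOfRecord₁₃SepCoPH F 2 θ h).C ∧ (0 < w.γ ∧ w.γ ≤ θ'.γ) ∧
        w.L = (θ'.L : ℝ) ∧ ∀ P : B12.RunParams, w.up P = upOfRecord₅CS F 2 (θ'.toStage5₁₃CoPH F 2) P) →
      (∀ P : B12.RunParams, Nodes (leavesP w P)) →
      ∀ γ₀ β' : ℝ, 0 < γ₀ → BetaUpperH β' γ₀ (datumOfRecord₁₃SepCoPH F 2 θ h).βfun →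
        ∃ γ₁ : ℝ, 0 < γ₁ ∧ γ₁ ≤ γ₀ ∧ BetaUpperH w.βup γ₁ (datumOfRecord₁₃SepCoPH F 2 θ h).βfun) :
    Summit.QuantumFields.YangMills.Theses.BalabanUVNodes.StabilityBAtRecordR13SepCoPH := by
  intro F hinh
  obtain ⟨θ, h, w, hU, hθ, hR, hnodes, -, -⟩ := h₁ F hinh
  obtain ⟨κ, hκ⟩ := hRem F
  have hpack := hκ θ h hθ
  exact ⟨θ, h, stabilityB_body_of_rung1At_of_remAt_of_d1Shadowing θ h w hU hθ hR hnodes κ hpack (hD1 F κ θ h hθ hpack) (hceil F θ h w hU hθ hR hnodes)⟩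

end Registered

end Summit.QuantumFields.YangMills.BalabanUVNodes.K1EndOfNodes13PWSOfK2NamedJets

end
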